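import Literature.Analysis.FluidPDE.NSFourierAPriori

/-!
# Route MarginalStabilityChain · BurgersLayerLowRe — the pointwise Poincaré substitute

Helper file (supports stmt-AnomalousDissipation-3010, `BurgersLayerLowRe`). With `h = e^{θy²/2}ω` one
has `h' = e^{θy²/2}(ω' + θyω)`, so Cauchy–Schwarz on `[0, y]`
(`Literature.Analysis.FluidPDE.FourierNS.sq_integral_mul_le`) gives
`‖ω(y) − ω(0)e^{−θy²/2}‖ ≤ e^{−θy²/4}(|y| ∫ e^{θs²/2}‖ω' + θsω‖²)^{1/2}`:
the distance of `ω` from the Gaussian `ω(0)e^{−θy²/2}` is controlled by the weighted Dirichlet form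
alone — a pointwise substitute for the Gaussian Poincaré inequality that needs no a priori membership
of `ω` in the weighted `L²` space. Folklore technique.
-/

noncomputable section

open MeasureTheory Set Filter Topology
open scoped Real RealInnerProductSpace Interval

namespace Summit.AnomalousDissipation.AnomalousDissipation.Theorems.MarginalStabilityChainBurgersLayerLowRe

-- the summit and its single sub-problem share the name `AnomalousDissipation` (tree layout D-0017)
set_option linter.dupNamespace false

/-! ### The pointwise Poincaré substitute -/

section Poincare

/-- **Pointwise Poincaré substitute.** With `h = e^{θy²/2} ω` one has `h' = e^{θy²/2}(ω' + θyω)`, so by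
Cauchy–Schwarz on `[0, y]`,
`‖ω(y) − e^{−θy²/2} ω(0)‖ ≤ e^{−θy²/4} (|y| ∫ e^{θs²/2}‖ω' + θsω‖²)^{1/2}`:
the distance of `ω` from the Gaussian `ω(0)e^{−θy²/2}` is controlled by the weighted Dirichlet form
alone (`θ ≥ 0`). [folklore] -/
theorem norm_sub_gauss_le {θ : ℝ} (hθ : 0 ≤ θ) {ω ω' : ℝ → ℂ} (hω : ∀ y, HasDerivAt ω (ω' y) y)
    (hω'c : Continuous ω')
    (hint : Integrable fun y => Real.exp (θ * y ^ 2 / 2) * ‖ω' y + ((θ * y : ℝ) : ℂ) * ω y‖ ^ 2) (y : ℝ) :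
    ‖ω y - ((Real.exp (-(θ * y ^ 2 / 2)) : ℝ) : ℂ) * ω 0‖ ≤
      Real.exp (-(θ * y ^ 2 / 4)) *
        Real.sqrt (|y| * ∫ s, Real.exp (θ * s ^ 2 / 2) * ‖ω' s + ((θ * s : ℝ) : ℂ) * ω s‖ ^ 2) := by
  have hωc : Continuous ω := continuous_iff_continuousAt.2 fun y => (hω y).continuousAt
  set ρ : ℝ → ℝ := fun s => Real.exp (θ * s ^ 2 / 2) with hρ
  set v : ℝ → ℂ := fun s => ω' s + ((θ * s : ℝ) : ℂ) * ω s with hv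
  set D : ℝ := ∫ s, ρ s * ‖v s‖ ^ 2 with hD
  have hρpos : ∀ s, 0 < ρ s := fun s => Real.exp_pos _
  have hρc : Continuous ρ := by simp only [hρ]; fun_prop
  have hvc : Continuous v := by simp only [hv]; fun_prop
  have hD0 : 0 ≤ D := integral_nonneg fun s => by have := hρpos s; positivity
  -- `h = ρ ω` and its derivative
  set H : ℝ → ℂ := fun s => ((ρ s : ℝ) : ℂ) * ω s with hH
  have hρd : ∀ s, HasDerivAt ρ (θ * s * ρ s) s := fun s => by
    have h := (((hasDerivAt_pow 2 s).const_mul θ).div_const 2).exp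
    refine h.congr_deriv ?_
    simp only [hρ, Nat.cast_ofNat]; ring
  have hhd : ∀ s, HasDerivAt H (((ρ s : ℝ) : ℂ) * v s) s := fun s => by
    have h1 := ((hρd s).ofReal_comp).mul (hω s)
    refine h1.congr_deriv ?_
    simp only [hv]; push_cast; ring
  have hh'c : Continuous fun s => ((ρ s : ℝ) : ℂ) * v s := by fun_prop
  have hftc : H y - H 0 = ∫ s in (0 : ℝ)..y, ((ρ s : ℝ) : ℂ) * v s :=
    (intervalIntegral.integral_eq_sub_of_hasDerivAt (fun s _ => hhd s) (hh'c.intervalIntegrable _ _)).symm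
  have hh0 : H 0 = ω 0 := by simp [hH, hρ]
  -- Cauchy–Schwarz on an ordered interval inside `[-|y|, |y|]`
  have hCS : ∀ a b : ℝ, a ≤ b → -|y| ≤ a → b ≤ |y| →
      (∫ s in a..b, ‖((ρ s : ℝ) : ℂ) * v s‖) ^ 2 ≤ ρ y * |y| * D * ((b - a) / |y|) ∨
        (∫ s in a..b, ‖((ρ s : ℝ) : ℂ) * v s‖) ^ 2 ≤ ρ y * (b - a) * D := by
    intro a b hab ha hb
    right
    have hfg : ∀ s, ‖((ρ s : ℝ) : ℂ) * v s‖ = Real.sqrt (ρ s) * (Real.sqrt (ρ s) * ‖v s‖) := fun s => by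
      rw [← mul_assoc, Real.mul_self_sqrt (hρpos s).le, norm_mul, Complex.norm_real, Real.norm_of_nonneg (hρpos s).le]
    have h1 := Literature.Analysis.FluidPDE.FourierNS.sq_integral_mul_le (f := fun s => Real.sqrt (ρ s))
      (g := fun s => Real.sqrt (ρ s) * ‖v s‖) (by fun_prop) (by fun_prop) hab
    simp_rw [← hfg] at h1
    refine h1.trans ?_
    have hf2 : ∫ s in a..b, Real.sqrt (ρ s) ^ 2 ≤ ρ y * (b - a) := by
      have hbd : ∀ s ∈ Ι a b, ‖Real.sqrt (ρ s) ^ 2‖ ≤ ρ y := by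
        intro s hs
        rw [Real.sq_sqrt (hρpos s).le, Real.norm_of_nonneg (hρpos s).le]
        simp only [hρ]
        rw [Real.exp_le_exp]
        have hs' : |s| ≤ |y| := by
          rw [Set.uIoc_of_le hab, Set.mem_Ioc] at hs
          rw [abs_le]; constructor <;> linarith
        have : s ^ 2 ≤ y ^ 2 := by nlinarith [abs_nonneg s, sq_abs s, sq_abs y]
        nlinarith
      have h := intervalIntegral.norm_integral_le_of_norm_le_const hbd
      rw [Real.norm_eq_abs, abs_of_nonneg (sub_nonneg.2 hab)] at h
      exact (le_abs_self _).trans h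
    have hg2 : ∫ s in a..b, (Real.sqrt (ρ s) * ‖v s‖) ^ 2 ≤ D := by
      have heq : ∀ s, (Real.sqrt (ρ s) * ‖v s‖) ^ 2 = ρ s * ‖v s‖ ^ 2 := fun s => by
        rw [mul_pow, Real.sq_sqrt (hρpos s).le]
      simp_rw [heq]
      rw [intervalIntegral.integral_of_le hab, hD]
      exact setIntegral_le_integral hint (Eventually.of_forall fun s => by have := hρpos s; positivity)
    have hf0 : 0 ≤ ∫ s in a..b, Real.sqrt (ρ s) ^ 2 := intervalIntegral.integral_nonneg hab fun s _ => sq_nonneg _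
    have hg0 : 0 ≤ ∫ s in a..b, (Real.sqrt (ρ s) * ‖v s‖) ^ 2 :=
      intervalIntegral.integral_nonneg hab fun s _ => sq_nonneg _
    calc (∫ s in a..b, Real.sqrt (ρ s) ^ 2) * ∫ s in a..b, (Real.sqrt (ρ s) * ‖v s‖) ^ 2
        ≤ (ρ y * (b - a)) * D := mul_le_mul hf2 hg2 hg0 (by have := hρpos y; nlinarith)
      _ = ρ y * (b - a) * D := by ring
  -- the interval integral of `‖h'‖` over `[0, y]`, in either orientation
  have hI : |∫ s in (0 : ℝ)..y, ‖((ρ s : ℝ) : ℂ) * v s‖| ^ 2 ≤ ρ y * |y| * D := by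
    rcases le_or_gt 0 y with hy | hy
    · rcases hCS 0 y hy (by linarith [abs_nonneg y]) (le_abs_self y) with h | h
      · rw [sq_abs]; rw [abs_of_nonneg hy] at h ⊢
        rcases eq_or_lt_of_le hy with h0 | h0
        · subst h0; simp
        · rwa [sub_zero, div_self h0.ne', mul_one] at h
      · rw [sq_abs, abs_of_nonneg hy]; simpa using h
    · rcases hCS y 0 hy.le (by rw [abs_of_neg hy]; linarith) (abs_nonneg y) with h | h
      · rw [intervalIntegral.integral_symm, abs_neg, sq_abs]
        rw [abs_of_neg hy] at h ⊢
        have hy0 : (-y) ≠ 0 := by linarith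
        rwa [zero_sub, div_self hy0, mul_one] at h
      · rw [intervalIntegral.integral_symm, abs_neg, sq_abs, abs_of_neg hy]; simpa using h
  -- assemble
  have hnorm : ‖H y - ω 0‖ ≤ Real.sqrt (ρ y) * Real.sqrt (|y| * D) := by
    rw [← hh0, hftc]
    refine (intervalIntegral.norm_integral_le_abs_integral_norm).trans ?_
    have h0 : 0 ≤ |∫ s in (0 : ℝ)..y, ‖((ρ s : ℝ) : ℂ) * v s‖| := abs_nonneg _
    have h1 : |∫ s in (0 : ℝ)..y, ‖((ρ s : ℝ) : ℂ) * v s‖| ^ 2 ≤ (Real.sqrt (ρ y) * Real.sqrt (|y| * D)) ^ 2 := by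
      rw [mul_pow, Real.sq_sqrt (hρpos y).le, Real.sq_sqrt (by positivity)]
      linarith [hI]
    have h2 : 0 ≤ Real.sqrt (ρ y) * Real.sqrt (|y| * D) := by positivity
    nlinarith [h1, h0, h2]
  have hfac : ω y - ((Real.exp (-(θ * y ^ 2 / 2)) : ℝ) : ℂ) * ω 0 = (((ρ y)⁻¹ : ℝ) : ℂ) * (H y - ω 0) := by
    have hρinv : Real.exp (-(θ * y ^ 2 / 2)) = (ρ y)⁻¹ := by simp only [hρ]; rw [Real.exp_neg]
    have hne : ((ρ y : ℝ) : ℂ) ≠ 0 := by exact_mod_cast (hρpos y).ne'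
    rw [hρinv, hH]
    push_cast
    field_simp
  have hsq : Real.sqrt (ρ y) = Real.exp (θ * y ^ 2 / 4) := by
    simp only [hρ]
    rw [show θ * y ^ 2 / 2 = θ * y ^ 2 / 4 + θ * y ^ 2 / 4 by ring, Real.exp_add, Real.sqrt_mul_self (Real.exp_pos _).le]
  calc ‖ω y - ((Real.exp (-(θ * y ^ 2 / 2)) : ℝ) : ℂ) * ω 0‖ = (ρ y)⁻¹ * ‖H y - ω 0‖ := by
        rw [hfac, norm_mul, Complex.norm_real, Real.norm_of_nonneg (inv_nonneg.2 (hρpos y).le)]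
    _ ≤ (ρ y)⁻¹ * (Real.sqrt (ρ y) * Real.sqrt (|y| * D)) := by gcongr
    _ = Real.exp (-(θ * y ^ 2 / 4)) * Real.sqrt (|y| * D) := by
        rw [hsq, ← mul_assoc]
        congr 1
        simp only [hρ]
        rw [← Real.exp_neg, ← Real.exp_add]
        congr 1; ring

end Poincare

end Summit.AnomalousDissipation.AnomalousDissipation.Theorems.MarginalStabilityChainBurgersLayerLowRe
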